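import Summits.Parity.BatemanHorn.Theses.AlmostPrimeZeros

/-!
# Crux `SystemZeroRepulsion` (stmt-Parity-11291): the parity content of the near-zone hypotheses

Route `AlmostPrimeZeros`, crux `Summit.Parity.BatemanHorn.Theses.AlmostPrimeZeros.SystemZeroRepulsion`;
line `smooth-rough-lattice-acquisition`.  Notation: `S_x(z) = Σ_{0 ≤ n ≤ x} z^{s_f(n)}`,
`s_f(n) = Σ_i Σ_{p^v ∥ f_i(n)} min(v,2)`, `L = log log x`, `U = log x / log log log x`, and the ROUGH
statistic `s♯_x(n) = Σ_i Σ_{p^v ∥ f_i(n), p > log log x} min(v,2)`.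

The crux has been reduced (`Theorems/AlmostPrimeZerosSystemZeroRepulsionReduction.lean`) to a far-zone
moment bound and ONE near-zone hypothesis, the disc majorant
`‖S_x(z)‖ ≤ A x (log x)^{k(Re z−1)} e^{C‖z−1‖^{3/2}}` on `‖z − 1‖ ≤ 3L` (or, inside the line, the rough
majorant S6 `‖Σ_{m₀≤n≤x} z^{s♯_x(n)}‖ ≤ A x U^{k(Re z−1)} e^{C‖z−1‖log(‖z−1‖+2)}`).  This file makes
the PARITY CONTENT of these hypotheses explicit in the kernel, by specialising them at `z = −1`
(which lies in the disc as soon as `3 log log x ≥ 2`):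

* `liouvilleSaving_of_discMajorant`: the disc majorant implies, for every Bateman–Horn system,
  `‖Σ_{n≤x} (−1)^{s_f(n)}‖ ≤ C (x+1)/(log x)^{2k}` for all `x ≥ 2` — a Liouville/Chowla-type
  cancellation ALONG THE POLYNOMIAL SYSTEM with a `(log x)^{2k}` saving (the conclusion is literally
  that of the landed necessity theorem `…EulerSpeciesFactorisation.stub_liouvilleSaving`, p87976,
  which derives the same bound from the crux itself);
* `roughLiouvilleSaving_of_roughMajorant`: S6 implies `‖Σ_{m₀≤n≤x} (−1)^{s♯_x(n)}‖ ≤ C x U^{−2k}`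
  from some `x₀(f, m₀)` on — rough Chowla along `f`.

So crux ⟹ LiouvilleSaving (p87976) and DiscMajorant ⟹ LiouvilleSaving (here): the near-zone
hypothesis of every line of this crux carries the same parity statement the crux carries, which is
open for every Bateman–Horn system other than `k = 0` and `k = 1, deg f = 1` (nonlinear `f`: Chowla
along an irreducible polynomial, open even as `o(x)`; `k ≥ 2` linear: a power-of-log two-point Chowla
bound for the capped Liouville function, open beyond logarithmically averaged `o(x)`).
-/

noncomputable section

namespace Summit.Parity.BatemanHorn.Cruxes.SystemZeroRepulsion.Reduction

open scoped BigOperators Nat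

/-- Numerics: for `x ≥ 16`, `2 ≤ 3 log log x` (so `z = −1` lies in the disc `‖z − 1‖ ≤ 3 log log x`)
and `0 < log x`. -/
private theorem two_le_three_loglog {x : ℝ} (hx : 16 ≤ x) :
    2 ≤ 3 * Real.log (Real.log x) ∧ 0 < Real.log x := by
  have h16 : Real.log 16 = 4 * Real.log 2 := by
    rw [show (16 : ℝ) = 2 ^ 4 by norm_num, Real.log_pow]; norm_num
  have hlog : Real.exp 1 ≤ Real.log x := by
    have h1 : Real.log 16 ≤ Real.log x := Real.log_le_log (by norm_num) hx
    have h2 : Real.exp 1 ≤ 4 * Real.log 2 := by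
      have := Real.exp_one_lt_d9; have := Real.log_two_gt_d9; linarith
    linarith
  have hpos : 0 < Real.log x := (Real.exp_pos 1).trans_le hlog
  refine ⟨?_, hpos⟩
  have h1 : 1 ≤ Real.log (Real.log x) := by
    rw [Real.le_log_iff_exp_le hpos]; exact hlog
  linarith

/-- `‖(-1 : ℂ) - 1‖ = 2`. -/
private theorem norm_neg_one_sub_one : ‖(-1 : ℂ) - 1‖ = 2 := by
  rw [show (-1 : ℂ) - 1 = -2 by norm_num, norm_neg]
  exact Complex.norm_two

/-- Real-power bookkeeping at `z = −1`: `(log x)^{k((−1) − 1)} = ((log x)^{2k})⁻¹` for `log x > 0`. -/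
private theorem rpow_at_neg_one {y : ℝ} (hy : 0 < y) (k : ℕ) :
    y ^ ((k : ℝ) * ((-1 : ℂ).re - 1)) = (y ^ (2 * k))⁻¹ := by
  have h : (k : ℝ) * ((-1 : ℂ).re - 1) = -((2 * k : ℕ) : ℝ) := by
    simp; ring
  rw [h, Real.rpow_neg hy.le, Real.rpow_natCast]

/-- **Parity content of the disc majorant.**  If every Bateman–Horn system admits the one-sided disc
majorant `‖S_x(z)‖ ≤ A x (log x)^{k(Re z−1)} e^{C‖z−1‖^{3/2}}` on `‖z − 1‖ ≤ 3 log log x` (`x ≥ x₀(f)`),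
then for every Bateman–Horn system `‖Σ_{n≤x} (−1)^{s_f(n)}‖ ≤ C' (x+1)/(log x)^{2k}` for ALL `x ≥ 2`.
Proof: at `z = −1`, `‖z − 1‖ = 2 ≤ 3 log log x` once `x ≥ 16`, and the majorant reads
`A x (log x)^{−2k} e^{C 2^{3/2}}`; the finitely many `2 ≤ x < max x₀ 16` are absorbed by the trivial bound
`x + 1 ≤ (log X)^{2k} (x+1)/(log x)^{2k}` (`X = max x₀ 16`, `log` monotone). -/
theorem liouvilleSaving_of_discMajorant :
    (∀ (k : ℕ) (f : Fin k → Polynomial ℤ), Literature.NumberTheory.Sieve.IsBatemanHornSystem f →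
      ∃ A C : ℝ, ∃ x₀ : ℕ, ∀ x : ℕ, x₀ ≤ x → ∀ z : ℂ, ‖z - 1‖ ≤ 3 * Real.log (Real.log (x : ℝ)) →
        ‖(∑ n ∈ Finset.range (x + 1), (z : ℂ) ^ (∑ i, (((f i).eval (n : ℤ)).toNat.factorization.sum fun _ v => min v 2)))‖ ≤
          A * (x : ℝ) * (Real.log (x : ℝ)) ^ ((k : ℝ) * ((z : ℂ).re - 1)) * Real.exp (C * ‖(z : ℂ) - 1‖ ^ (3 / 2 : ℝ))) →
    ∀ (k : ℕ) (f : Fin k → Polynomial ℤ), Literature.NumberTheory.Sieve.IsBatemanHornSystem f →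
      ∃ C : ℝ, ∀ x : ℕ, 2 ≤ x →
        ‖∑ n ∈ Finset.range (x + 1), (-1 : ℂ) ^ (∑ i, (((f i).eval (n : ℤ)).toNat.factorization.sum fun _ v => min v 2))‖ ≤
          C * ((x : ℝ) + 1) / (Real.log (x : ℝ)) ^ (2 * k) := by
  intro hdisc k f hf
  obtain ⟨A, C, x₀, h⟩ := hdisc k f hf
  set X : ℕ := max x₀ 16 with hX
  -- constants: `K₁` for large `x`, `K₂` for the finitely many small `x`
  set K₁ : ℝ := max A 0 * Real.exp (C * (2 : ℝ) ^ (3 / 2 : ℝ)) with hK₁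
  set K₂ : ℝ := (Real.log (X : ℝ)) ^ (2 * k) with hK₂
  have hK₁0 : 0 ≤ K₁ := by positivity
  have hX16 : (16 : ℝ) ≤ (X : ℝ) := by exact_mod_cast le_max_right x₀ 16
  have hlogX : 0 < Real.log (X : ℝ) := (two_le_three_loglog hX16).2
  have hK₂0 : 0 ≤ K₂ := pow_nonneg hlogX.le _
  refine ⟨K₁ + K₂, fun x hx2 => ?_⟩
  have hx2r : (2 : ℝ) ≤ x := by exact_mod_cast hx2
  have hlogx : 0 < Real.log (x : ℝ) := Real.log_pos (by linarith)
  have hpow : 0 < (Real.log (x : ℝ)) ^ (2 * k) := pow_pos hlogx _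
  -- trivial bound `‖Σ (−1)^{s}‖ ≤ x + 1`
  have htriv : ‖∑ n ∈ Finset.range (x + 1), (-1 : ℂ) ^
      (∑ i, (((f i).eval (n : ℤ)).toNat.factorization.sum fun _ v => min v 2))‖ ≤ (x : ℝ) + 1 := by
    refine (norm_sum_le _ _).trans ?_
    have : ∀ n ∈ Finset.range (x + 1), ‖(-1 : ℂ) ^
        (∑ i, (((f i).eval (n : ℤ)).toNat.factorization.sum fun _ v => min v 2))‖ ≤ 1 := by
      intro n _; simp
    refine (Finset.sum_le_sum this).trans ?_
    simp
  rw [le_div_iff₀ hpow]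
  rcases le_or_gt X x with hxX | hxX
  · -- large `x`: specialise the disc majorant at `z = −1`
    have hx₀ : x₀ ≤ x := le_trans (le_max_left _ _) hxX
    have hx16 : (16 : ℝ) ≤ x := hX16.trans (by exact_mod_cast hxX)
    obtain ⟨h23, -⟩ := two_le_three_loglog hx16
    have hz : ‖(-1 : ℂ) - 1‖ ≤ 3 * Real.log (Real.log (x : ℝ)) := by rw [norm_neg_one_sub_one]; exact h23
    have hmain := h x hx₀ (-1) hz
    rw [rpow_at_neg_one hlogx, norm_neg_one_sub_one] at hmain
    -- `A x (L^{2k})⁻¹ e^{…} · L^{2k} = A e^{…} x ≤ K₁ (x+1)`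
    have hx0 : (0 : ℝ) ≤ x := by positivity
    calc ‖∑ n ∈ Finset.range (x + 1), (-1 : ℂ) ^
          (∑ i, (((f i).eval (n : ℤ)).toNat.factorization.sum fun _ v => min v 2))‖ * Real.log (x : ℝ) ^ (2 * k)
        ≤ A * (x : ℝ) * ((Real.log (x : ℝ)) ^ (2 * k))⁻¹ * Real.exp (C * (2 : ℝ) ^ (3 / 2 : ℝ)) *
            Real.log (x : ℝ) ^ (2 * k) := mul_le_mul_of_nonneg_right hmain hpow.le
      _ = A * Real.exp (C * (2 : ℝ) ^ (3 / 2 : ℝ)) * (x : ℝ) := by field_simp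
      _ ≤ K₁ * (x : ℝ) := by
          refine mul_le_mul_of_nonneg_right ?_ hx0
          exact mul_le_mul_of_nonneg_right (le_max_left A 0) (Real.exp_pos _).le
      _ ≤ (K₁ + K₂) * ((x : ℝ) + 1) := by nlinarith
  · -- small `x`: `(log x)^{2k} ≤ (log X)^{2k} = K₂`
    have hxX' : (x : ℝ) ≤ X := by exact_mod_cast hxX.le
    have hlogle : Real.log (x : ℝ) ≤ Real.log (X : ℝ) := Real.log_le_log (by linarith) hxX'
    have hpowle : (Real.log (x : ℝ)) ^ (2 * k) ≤ K₂ := pow_le_pow_left₀ hlogx.le hlogle _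
    calc ‖∑ n ∈ Finset.range (x + 1), (-1 : ℂ) ^
          (∑ i, (((f i).eval (n : ℤ)).toNat.factorization.sum fun _ v => min v 2))‖ * Real.log (x : ℝ) ^ (2 * k)
        ≤ ((x : ℝ) + 1) * K₂ := mul_le_mul htriv hpowle hpow.le (by positivity)
      _ ≤ (K₁ + K₂) * ((x : ℝ) + 1) := by nlinarith

/-- **Parity content of the rough majorant S6.**  If for every Bateman–Horn system and every `m₀` the
rough sum obeys `‖Σ_{m₀≤n≤x} z^{s♯_x(n)}‖ ≤ A x U^{k(Re z−1)} e^{C‖z−1‖ log(‖z−1‖+2)}` on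
`‖z − 1‖ ≤ 3 log log x` (`U = log x/log log log x`, `x ≥ x₀`), then at `z = −1`:
`‖Σ_{m₀≤n≤x} (−1)^{s♯_x(n)}‖ ≤ A e^{2C log 4} · x · U^{−2k}` for `x ≥ max x₀ 16` — rough Chowla along `f`
with the saving `U^{2k}`.  (Stated with the real power `U^{k((−1)−1)}` exactly as S6 delivers it.) -/
theorem roughLiouvilleSaving_of_roughMajorant :
    (∀ (k : ℕ) (f : Fin k → Polynomial ℤ), Literature.NumberTheory.Sieve.IsBatemanHornSystem f →
      ∀ m₀ : ℕ, ∃ A C : ℝ, ∃ x₀ : ℕ, ∀ x : ℕ, x₀ ≤ x → ∀ z : ℂ, ‖z - 1‖ ≤ 3 * Real.log (Real.log (x : ℝ)) →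
        ‖(∑ n ∈ Finset.Ico m₀ (x + 1), (z : ℂ) ^ (∑ i, (((f i).eval (n : ℤ)).toNat.factorization.sum fun p v => if Real.log (Real.log (x : ℝ)) < (p : ℝ) then min v 2 else 0)))‖ ≤
          A * (x : ℝ) * (Real.log (x : ℝ) / Real.log (Real.log (Real.log (x : ℝ)))) ^ ((k : ℝ) * (z.re - 1)) * Real.exp (C * ‖(z : ℂ) - 1‖ * Real.log (‖(z : ℂ) - 1‖ + 2))) →
    ∀ (k : ℕ) (f : Fin k → Polynomial ℤ), Literature.NumberTheory.Sieve.IsBatemanHornSystem f →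
      ∀ m₀ : ℕ, ∃ C : ℝ, ∃ x₀ : ℕ, ∀ x : ℕ, x₀ ≤ x →
        ‖∑ n ∈ Finset.Ico m₀ (x + 1), (-1 : ℂ) ^ (∑ i, (((f i).eval (n : ℤ)).toNat.factorization.sum fun p v => if Real.log (Real.log (x : ℝ)) < (p : ℝ) then min v 2 else 0))‖ ≤
          C * (x : ℝ) * (Real.log (x : ℝ) / Real.log (Real.log (Real.log (x : ℝ)))) ^ ((k : ℝ) * ((-1 : ℂ).re - 1)) := by
  intro hS6 k f hf m₀
  obtain ⟨A, C, x₀, h⟩ := hS6 k f hf m₀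
  refine ⟨A * Real.exp (C * 2 * Real.log 4), max x₀ 16, fun x hx => ?_⟩
  have hx₀ : x₀ ≤ x := le_of_max_le_left hx
  have hx16 : (16 : ℝ) ≤ x := by exact_mod_cast le_of_max_le_right hx
  obtain ⟨h23, -⟩ := two_le_three_loglog hx16
  have hz : ‖(-1 : ℂ) - 1‖ ≤ 3 * Real.log (Real.log (x : ℝ)) := by rw [norm_neg_one_sub_one]; exact h23
  have hmain := h x hx₀ (-1) hz
  rw [norm_neg_one_sub_one, show (2 : ℝ) + 2 = 4 by norm_num] at hmain
  calc ‖∑ n ∈ Finset.Ico m₀ (x + 1), (-1 : ℂ) ^ (∑ i, (((f i).eval (n : ℤ)).toNat.factorization.sum fun p v => if Real.log (Real.log (x : ℝ)) < (p : ℝ) then min v 2 else 0))‖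
      ≤ A * (x : ℝ) * (Real.log (x : ℝ) / Real.log (Real.log (Real.log (x : ℝ)))) ^ ((k : ℝ) * ((-1 : ℂ).re - 1)) *
          Real.exp (C * 2 * Real.log 4) := hmain
    _ = A * Real.exp (C * 2 * Real.log 4) * (x : ℝ) *
          (Real.log (x : ℝ) / Real.log (Real.log (Real.log (x : ℝ)))) ^ ((k : ℝ) * ((-1 : ℂ).re - 1)) := by ring

end Summit.Parity.BatemanHorn.Cruxes.SystemZeroRepulsion.Reduction

end
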